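import Literature.MathematicalPhysics.QuantumFieldTheory.Balaban1983to89.B6Line3CubeV1
import Literature.MathematicalPhysics.QuantumFieldTheory.Balaban1983to89.B6SchurTorusBound
import Literature.MathematicalPhysics.QuantumFieldTheory.Balaban1983to89.B6RandomWalkKernel
import HarnessLib

/-!
# `Balaban1983to89.B6Ineq2140KLevelV1` — T. Bałaban, *Propagators and renormalization transformations for lattice gauge theories. II*,
# Commun. Math. Phys. **96** (1984) 223–250 [Balaban1984PropagatorsII], Proposition 2.6, THE FIRST `L²` ENTRY OF (2.140) p. 247
# `‖ζGJ‖ ≤ O(1)(Lʲη)²|ζ|e^{−δ₃d(y,y′)}‖J‖` AT k LEVELS FOR THE GENUINE `G = Δ_a⁻¹` ON THE V1 TORUS (B6-CLOSURE §5 item 16 addendum: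
# «(2.137)–(2.141) at k levels»), BY THE SCHUR TEST ON ONE BLOCK PAIR FROM THE LANDED SUP MAJORANT (2.136)₁ AND THE SYMMETRY OF `G`

statement-level skeleton of published theorems with citation tags; proofs where landed; nothing here is a claim about the Yang–Mills mass gap

WHAT IS PRINTED (p. 247 [PDF 25], Proposition 2.6, verbatim up to notation): *"There exists a positive constant δ₃ depending on d and L only,
such that |(GJ)(x)|, |(∇GJ)(x)|, |(G∇*J)(x)|, |(ΔGJ)(x)| ≤ O(1)[(Lʲη)², Lʲη, Lʲη, 1]e^{−δ₃d(y,y′)}|J| (2.136) for x ∈ Δ(y), y ∈ Λ_j,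
supp J ⊂ Δ(y′), with the constant O(1) depending on d and L only; … ‖ζGJ‖, ‖ζ∇GJ‖, ‖ζG∇*J‖, ‖ζ∇G∇*J‖, ‖ζ∇∇GJ‖, ‖ζG∇*∇*J‖ ≤
O(1)[(Lʲη)², Lʲη, Lʲη, 1, 1, 1]|ζ|e^{−δ₃d(y,y′)}‖J‖ (2.140) if supp ζ ⊂ Δ(y), y ∈ Λ_j, supp J ⊂ Δ(y′), with the constant O(1) depending on
d and L. The operator G can be represented as G = G₀(I − R)⁻¹ = Σ_{n=0}^∞ G₀Rⁿ = Σ_ω h_{□₀}G_{□₀}h_{□₀}K_{□₁,□₂}G_{□₂}h_{□₂}·…·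
K_{□_{2n−1},□_{2n}}G_{□_{2n}}h_{□_{2n}}, (2.141) and the series above is convergent in the norms appearing in the inequalities (2.136)–(2.140)."*
(p. 226 (2.22): *"where G = Δ_a⁻¹"*; p. 224 (2.2): *"(Lʲη)⁻¹dist(Ω_jᶜ, Ω_{j+1}) > RM"*.)

CITATION HEADER (lean-in-tree rule) — WHAT IS REPRODUCED.  Phase-2 file of the `lit-balaban` typed skeleton (HOME `run/shared/lean/pub/lit-balaban/`),
seat **p22 gen 23**, lane B6 §C (fold owner r03, referee ref-4); SKELETON row **B6.Prop2.6** (member cell; the head is r03's).  THE FIRST `L²`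
ENTRY OF (2.140) FOR THE GENUINE k-LEVEL OPERATOR `G = Δ_a⁻¹ = GE (domT hN D hk)` of ROUTE V (r03/p21/p38/p22 lineage) on the V1 torus, from
r03's landed sup majorant `B6Line3CubeV1.prop26_2136_kLevel_unconditional` ((2.136)₁ with NO displayed analytic hypothesis, p366020) BY NAME:
* §1 (GENERIC, any block geometry `g`, any finite carrier `X`) **`sum_sq_cut_apply_le_of_hasMajorant_pair`**: a block majorant `K` of `T`
  ([Balaban1984PropagatorsII] (2.51): `|(Tμ)(x)| ≤ K(y,y′)|μ|`) AND a block majorant `K′` of the TRANSPOSE `Tᵀ` give, for `supp ζ ⊂ Δ(y)`,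
  `|ζ| ≤ s`, `supp J ⊂ Δ(y′)`: `Σ_x (ζ(x)(TJ)(x))² ≤ s²·K(y,y′)K′(y′,y)·Σ_x J(x)²` — the SCHUR TEST on the kernel truncated to the block pair
  (row sums from `K` by the sign test function `rowSum_le_of_hasMajorant`, column sums from `K′`; core `B6SchurTorusBound.sum_sq_le_abs`) — the
  route recorded for [Balaban1985BackgroundPropagators] (3.46)₁₋₃ in the header of the pub-balaban file `SchurTest.lean`;
* §2 the symmetric case: `onFun f` has symmetric entries when `f† = f` (`onFun_single_symm`, via r03's `B6AgreeLapV1Chart.adjoint_single_apply`),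
  and **`adjoint_GE`**: `G† = G` (p21's `B6SectAVectorModelV1.inner_GE_left`);
* §3 THE LEVEL FACTOR on p21's torus geometry `geomT D`: **`pref_le_of_levelGap`** `pref(y′) ≤ L²·e^{δ·d_T(y,y′)}·pref(y)` as soon as
  `2·log L ≤ δ·(R·L·M_h − 1)` — from the walk form of (2.2) `B6Geom246MultiLevelTorus.levelGapT` and `B6Geometry.levelGap_dist_real`
  (`(R·L·M_h − 1)·(|j − j′| − 1)⁺ ≤ d_T(y,y′)`), i.e. the printed prefactor `(Lʲη)²` of the OUTPUT block absorbs the geometric mean with the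
  input block's `(L^{j′}η)²` at the cost of half the rate, for `M` large (print: «M is a size of big blocks … which will be fixed later», p. 224);
* §4 **`sum_sq_le_of_hasMajorant_GE`** (the three steps combined for the genuine `G` under a majorant of the landed shape `A·pref·e^{−δd_T}`) and the
  two k-level statements **`ineq2140_kLevel_unconditional`** (binders of r03's `prop26_2136_kLevel_unconditional` VERBATIM except `α < 1`, with
  `M₂` enlarged; conclusion: for all blocks `y, y′`, cut-offs `ζ` supported in `Δ(y)` with `|ζ| ≤ s` and sources `J` supported in `Δ(y′)`,
  `Σ_x (ζ(x)(GJ)(x))² ≤ (A·pref cf y·e^{−(δ₃(α,2σ)/2)·d_T(y,y′)}·s)²·Σ_x J(x)²`) and **`ineq2140_kLevel_unconditional_L5`** (from r03's `_L5`: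
  `L = 5`, `P′_μ ≥ 12`, no placement hypothesis).
HONEST SCOPE: (1) ONLY the first of the six `L²` entries of (2.140): the entries `‖ζ∇GJ‖`, `‖ζG∇*J‖` would need by this route the sup entry
(2.136)₃ `G∇*` at k levels (not in the tree), and `‖ζ∇G∇*J‖`, `‖ζ∇∇GJ‖`, `‖ζG∇*∇*J‖` have no `∞ → ∞` partner at all (print's route for them is
the walk (2.141) with the `L²` legs of [Balaban1984PropagatorsI] (1.114) — the two-scale `B6L2Block*` lineage — NOT attempted here); (2) the
`L²` norms are the unweighted `ℓ²` sums over the fine bonds of the V1 torus on both sides (print's `η^d`-weighted norms differ from them by the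
same factor on both sides); (3) rate `δ₃(α,2σ)/2` and constant `A·L` are OURS (print: «O(1) depending on d and L», «δ₃ depending on d and L
only»); the threshold `M₂` depends on `d, L, b₀, b₁, σ, α`; (4) everything else as in `B6Line3CubeV1` (V1 torus, `k ≥ 2`, `M_h = L^a ≥ 8`,
`R ≥ 2L²`, `P′_μ ≥ 5`, odd `L ≥ 5` with the placement hypothesis, or `L = 5`, `P′_μ ≥ 12` without it; weights in the band (2.16)).
DEVIATION FROM PRINT (said once): print obtains (2.140) «reasoning in the same way as in the proof of Proposition 2.2», i.e. through (2.141)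
with `L²` legs; here the first entry is DERIVED from the landed sup entry (2.136)₁ by symmetry + Schur — a genuinely shorter road for this
entry only.  IMPORTS BY NAME, restating nothing; THEOREMS ONLY (no definition, no `def … : Prop`); standard axioms.  NOT summit progress.
Unit `lit-balaban-p22` (gen 23), 2026-08-23.
-/

noncomputable section

open scoped BigOperators InnerProductSpace
open Finset

namespace Literature.MathematicalPhysics.QuantumFieldTheory.Balaban1983to89.B6Ineq2140KLevelV1

open LatticeFieldCalculus
open B6RandomWalk (HasMajorant hasMajorant_mono BlockSupp delta3 delta3_pos)
open B6RandomWalkKernel (apply_eq_sum_single)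
open B6SchurTorusBound (sum_sq_le_abs)
open B6Ineq2133TwoScaleV1 (onFun onFun_apply)
open B6AgreeLapV1Chart (adjoint_single_apply)
open B6SectAOperatorsV1 (BondIdx)
open B6SectAVectorModelV1 (GE inner_GE_left)
open B6MultiLevelBoxOperator (N0)
open B6MultiLevelTorusOperator (TDomains)
open B6Geom246MultiLevelTorus (geomT bondT levelGapT connectedT)
open B6Geometry (LevelGap levelGap_dist_real)
open B6GlobalChartV1 (PV domT blkV1)
open B6Prop26KLevelSkeletonV1 (pref pref_nonneg)
open B6Cover236MultiLevelBlocks (cubes)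
open B6CubeWindowV1 (Placed GlobalBand)
open B6Line3CubeV1 (prop26_2136_kLevel_unconditional prop26_2136_kLevel_unconditional_L5)

/-! ## §1  The Schur test on one block pair from a majorant of `T` and a majorant of `Tᵀ` -/

section Schur

variable {g : B6.Geometry} [DecidableEq g.Site] {X : Type} [Fintype X] [DecidableEq X]

/-- **ROW SUMS FROM THE MAJORANT**: if `|(Tμ)(x)| ≤ K(y(x), y′)·|μ|` for `supp μ ⊂ Δ(y′)` ((2.51)), then the absolute row sum of the kernel of `T`
over the block `Δ(y′)` is at most `K(y(x), y′)` (test `T` against the sign pattern of the row).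
[cite: Balaban1984PropagatorsII, (2.51)–(2.52) p.232 (operators and their kernels; derivation ours)] -/
theorem rowSum_le_of_hasMajorant (blk : X → g.Site) {T : Module.End ℝ (X → ℝ)} {K : g.Site → g.Site → ℝ}
    (hT : HasMajorant blk T K) (x : X) (y' : g.Site) :
    ∑ x' ∈ univ.filter (fun x' => blk x' = y'), |T (Pi.single x' 1) x| ≤ K (blk x) y' := by
  -- the sign pattern of the row `x` on the block `Δ(y′)`
  set μ : X → ℝ := fun x' => if blk x' = y' then (if 0 ≤ T (Pi.single x' 1) x then 1 else -1) else 0 with hμ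
  have hμ_in : ∀ x', blk x' = y' → μ x' * T (Pi.single x' 1) x = |T (Pi.single x' 1) x| ∧ |μ x'| ≤ 1 := by
    intro x' hx'
    by_cases h0 : 0 ≤ T (Pi.single x' 1) x
    · have hval : μ x' = 1 := by simp only [hμ, hx', h0, if_true]
      rw [hval, one_mul, abs_of_nonneg h0, abs_one]
      exact ⟨rfl, le_rfl⟩
    · have hval : μ x' = -1 := by simp only [hμ, hx', h0, if_true, if_false]
      rw [hval, neg_one_mul, abs_of_neg (lt_of_not_ge h0), abs_neg, abs_one]
      exact ⟨rfl, le_rfl⟩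
  have hμ_out : ∀ x', blk x' ≠ y' → μ x' = 0 := fun x' hx' => by simp only [hμ, hx', if_false]
  have hsupp : BlockSupp blk μ y' 1 := ⟨zero_le_one, fun x' hx' => (hμ_in x' hx').2, hμ_out⟩
  have h := hT y' μ 1 hsupp x
  rw [mul_one] at h
  have hexp : T μ x = ∑ x' ∈ univ.filter (fun x' => blk x' = y'), |T (Pi.single x' 1) x| := by
    rw [apply_eq_sum_single, Finset.sum_filter]
    refine Finset.sum_congr rfl fun x' _ => ?_
    by_cases hx' : blk x' = y'
    · rw [if_pos hx', (hμ_in x' hx').1]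
    · rw [if_neg hx', hμ_out x' hx', zero_mul]
  rw [← hexp]
  exact (le_abs_self _).trans h

/-- **THE SCHUR TEST ON ONE BLOCK PAIR** — a majorant `K` of `T` and a majorant `K′` of the transpose `Tᵀ` (`Tᵀ(x′, x) = T(x, x′)`) bound the
`L²` norm of the block `1_{Δ(y)}T1_{Δ(y′)}` by `√(K(y,y′)K′(y′,y))`: for `supp ζ ⊂ Δ(y)`, `|ζ| ≤ s`, `supp J ⊂ Δ(y′)`,
`Σ_x (ζ(x)(TJ)(x))² ≤ s²K(y,y′)K′(y′,y)·Σ_x J(x)²` (the shape of (2.140) on one block pair).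
[cite: Balaban1984PropagatorsII, Prop. 2.6 (2.140) p.247 (shape); (2.51) p.232; derivation ours (Schur test)] -/
theorem sum_sq_cut_apply_le_of_hasMajorant_pair (blk : X → g.Site) {T T' : Module.End ℝ (X → ℝ)} {K K' : g.Site → g.Site → ℝ}
    (hT : HasMajorant blk T K) (hT' : HasMajorant blk T' K') (hK : ∀ y y', 0 ≤ K y y') (hK' : ∀ y y', 0 ≤ K' y y')
    (htr : ∀ x x', T' (Pi.single x 1) x' = T (Pi.single x' 1) x)
    (y y' : g.Site) (ζ J : X → ℝ) {s : ℝ} (hζ : ∀ x, blk x ≠ y → ζ x = 0) (hζs : ∀ x, |ζ x| ≤ s)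
    (hJ : ∀ x, blk x ≠ y' → J x = 0) :
    ∑ x, (ζ x * T J x) ^ 2 ≤ s ^ 2 * (K y y' * K' y' y) * ∑ x, J x ^ 2 := by
  -- the kernel of `T` truncated to the block pair `Δ(y) × Δ(y′)`
  set Tk : X → X → ℝ := fun x x' => if blk x = y ∧ blk x' = y' then T (Pi.single x' 1) x else 0 with hTk
  have hrow : ∀ x, ∑ x', |Tk x x'| ≤ K y y' := by
    intro x
    by_cases hx : blk x = y
    · calc ∑ x', |Tk x x'| = ∑ x' ∈ univ.filter (fun x' => blk x' = y'), |T (Pi.single x' 1) x| := by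
            rw [Finset.sum_filter]
            refine Finset.sum_congr rfl fun x' _ => ?_
            by_cases hx' : blk x' = y' <;> simp [hTk, hx, hx']
        _ ≤ K (blk x) y' := rowSum_le_of_hasMajorant blk hT x y'
        _ = K y y' := by rw [hx]
    · have h0 : ∑ x', |Tk x x'| = 0 := Finset.sum_eq_zero fun x' _ => by simp [hTk, hx]
      rw [h0]
      exact hK y y'
  have hcol : ∀ x', ∑ x, |Tk x x'| ≤ K' y' y := by
    intro x'
    by_cases hx' : blk x' = y'
    · calc ∑ x, |Tk x x'| = ∑ x ∈ univ.filter (fun x => blk x = y), |T' (Pi.single x 1) x'| := by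
            rw [Finset.sum_filter]
            refine Finset.sum_congr rfl fun x _ => ?_
            by_cases hx : blk x = y <;> simp [hTk, hx, hx', htr]
        _ ≤ K' (blk x') y := rowSum_le_of_hasMajorant blk hT' x' y
        _ = K' y' y := by rw [hx']
    · have h0 : ∑ x, |Tk x x'| = 0 := Finset.sum_eq_zero fun x _ => by simp [hTk, hx']
      rw [h0]
      exact hK' y' y
  -- on the rows of `Δ(y)`, `(TJ)(x) = Σ_{x′} Tk(x,x′)J(x′)` since `J` vanishes off `Δ(y′)`
  have hTJ : ∀ x, blk x = y → T J x = ∑ x', Tk x x' * J x' := by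
    intro x hx
    rw [apply_eq_sum_single]
    refine Finset.sum_congr rfl fun x' _ => ?_
    by_cases hx' : blk x' = y'
    · simp [hTk, hx, hx', mul_comm]
    · rw [hJ x' hx']
      simp [hTk, hx']
  have hs2 : ∀ x, ζ x ^ 2 ≤ s ^ 2 := fun x => by
    rw [← sq_abs (ζ x)]
    exact pow_le_pow_left₀ (abs_nonneg _) (hζs x) 2
  have hpt : ∀ x, (ζ x * T J x) ^ 2 ≤ s ^ 2 * (∑ x', Tk x x' * J x') ^ 2 := by
    intro x
    by_cases hx : blk x = y
    · rw [hTJ x hx, mul_pow]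
      exact mul_le_mul_of_nonneg_right (hs2 x) (sq_nonneg _)
    · rw [hζ x hx, zero_mul, zero_pow two_ne_zero]
      positivity
  have hS := sum_sq_le_abs Tk J (hK y y') hrow hcol
  calc ∑ x, (ζ x * T J x) ^ 2 ≤ ∑ x, s ^ 2 * (∑ x', Tk x x' * J x') ^ 2 := Finset.sum_le_sum fun x _ => hpt x
    _ = s ^ 2 * ∑ x, (∑ x', Tk x x' * J x') ^ 2 := by rw [Finset.mul_sum]
    _ ≤ s ^ 2 * (K y y' * K' y' y * ∑ x', J x' ^ 2) := mul_le_mul_of_nonneg_left hS (sq_nonneg _)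
    _ = s ^ 2 * (K y y' * K' y' y) * ∑ x, J x ^ 2 := by ring

/-- **THE SYMMETRIC CASE**: one majorant `K` of a `T` with symmetric kernel gives `Σ_x (ζ(x)(TJ)(x))² ≤ s²K(y,y′)K(y′,y)·Σ_x J(x)²`.
[cite: Balaban1984PropagatorsII, Prop. 2.6 (2.140) p.247 (shape); derivation ours (Schur test)] -/
theorem sum_sq_cut_apply_le_of_hasMajorant_symm (blk : X → g.Site) {T : Module.End ℝ (X → ℝ)} {K : g.Site → g.Site → ℝ}
    (hT : HasMajorant blk T K) (hK : ∀ y y', 0 ≤ K y y') (hsymm : ∀ x x', T (Pi.single x 1) x' = T (Pi.single x' 1) x)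
    (y y' : g.Site) (ζ J : X → ℝ) {s : ℝ} (hζ : ∀ x, blk x ≠ y → ζ x = 0) (hζs : ∀ x, |ζ x| ≤ s)
    (hJ : ∀ x, blk x ≠ y' → J x = 0) :
    ∑ x, (ζ x * T J x) ^ 2 ≤ s ^ 2 * (K y y' * K y' y) * ∑ x, J x ^ 2 :=
  sum_sq_cut_apply_le_of_hasMajorant_pair blk hT hT hK hK hsymm y y' ζ J hζ hζs hJ

end Schur

/-! ## §2  Symmetric entries: `onFun f` for a self-adjoint `f`, and `G† = G` -/

section Symm

variable {ι : Type} [Fintype ι] [DecidableEq ι]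

/-- the bond-function reading `onFun f` of a SELF-ADJOINT operator of `ℓ²` has a symmetric kernel: `(f δ_x)(x′) = (f δ_{x′})(x)`.
[cite: Balaban1984PropagatorsII, (2.8) p.224 («the adjoint operator»), (2.22) p.226; dictionary] -/
theorem onFun_single_symm (f : EuclideanSpace ℝ ι →ₗ[ℝ] EuclideanSpace ℝ ι) (hf : LinearMap.adjoint f = f) (x x' : ι) :
    onFun f (Pi.single x 1) x' = onFun f (Pi.single x' 1) x := by
  have h := adjoint_single_apply f x x'
  rw [hf] at h
  exact h

/-- **`G† = G`**: the genuine `G = Δ_a⁻¹` is self-adjoint (p. 226: `Δ_a` symmetric, `G = Δ_a⁻¹`; p21's `inner_GE_left`).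
[cite: Balaban1984PropagatorsII, (2.19) p.226, (2.22) p.226] -/
theorem adjoint_GE {P : Params} (Dm : B6SectADomainsV1.Domains P) {c : ℝ} (hc : c ≠ 0) {w : BondIdx Dm → ℝ} (hw : ∀ i, 0 < w i) :
    LinearMap.adjoint (GE Dm hc hw) = GE Dm hc hw := by
  symm
  rw [LinearMap.eq_adjoint_iff]
  intro x y
  exact inner_GE_left Dm hc hw x y

/-- hence the kernel of `onFun G` is symmetric. [cite: Balaban1984PropagatorsII, (2.22) p.226] -/
theorem onFun_GE_single_symm {P : Params} (Dm : B6SectADomainsV1.Domains P) {c : ℝ} (hc : c ≠ 0) {w : BondIdx Dm → ℝ}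
    (hw : ∀ i, 0 < w i) (x x' : PBond P 0) :
    onFun (GE Dm hc hw) (Pi.single x 1) x' = onFun (GE Dm hc hw) (Pi.single x' 1) x :=
  onFun_single_symm (GE Dm hc hw) (adjoint_GE Dm hc hw) x x'

end Symm

/-! ## §3  The level factor on the torus geometry: `pref(y′) ≤ L²e^{δd_T(y,y′)}pref(y)` for `M` large -/

section Level

variable {d ℓ Mh k R : ℕ} {P' : Fin (d + 1) → ℕ}

/-- the torus distance of `geomT D` is the graph distance of the admissible bonds. [cite: Balaban1984PropagatorsII, (2.46) p.231] -/
theorem geomT_dist_eq (D : TDomains d ℓ Mh k P' R) (y y' : (geomT D).Site) :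
    (geomT D).dist y y' = ((bondT D).dist y y' : ℝ) := rfl

/-- `d_T ≥ 0`. [cite: Balaban1984PropagatorsII, (2.46) p.231] -/
theorem geomT_dist_nonneg (D : TDomains d ℓ Mh k P' R) (y y' : (geomT D).Site) : 0 ≤ (geomT D).dist y y' := by
  rw [geomT_dist_eq]; exact Nat.cast_nonneg _

/-- the printed prefactor written out: `pref c′ y = (L^{j(y)})²/c′²`. [cite: Balaban1984PropagatorsII, (2.136) p.247] -/
theorem pref_eq (c' : ℝ) {D : TDomains d ℓ Mh k P' R} (y : (geomT D).Site) :
    pref c' y = ((((ℓ + 1 : ℕ) : ℝ)) ^ y.1.1) ^ 2 / c' ^ 2 := by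
  rw [pref, div_pow]

/-- **THE LEVEL SEPARATION** (walk form of (2.2)): `(R·L·M_h − 1)·(|j(y) − j(y′)| − 1)⁺ ≤ d_T(y, y′)`.
[cite: Balaban1984PropagatorsII, (2.2) p.224, (2.57) p.233, (2.60) p.234] -/
theorem levelGap_le_dist (D : TDomains d ℓ Mh k P' R) (hMh : 1 ≤ Mh) (hP : ∀ μ, 1 ≤ P' μ) (y y' : (geomT D).Site) :
    (((R * ((ℓ + 1) * Mh) - 1 : ℕ)) : ℝ) * max (|(y.1.1 : ℝ) - y'.1.1| - 1) 0 ≤ (geomT D).dist y y' := by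
  rw [geomT_dist_eq]
  exact levelGap_dist_real (connectedT hMh hP) (levelGapT D) y y'

/-- **POWERS OF `L` ACROSS LEVELS**: `(L^{j′})² ≤ L²·e^{δd_T(y,y′)}·(L^{j})²` for `j = j(y)`, `j′ = j(y′)`, whenever `2 log L ≤ δ·(R·L·M_h − 1)`.
[cite: Balaban1984PropagatorsII, (2.2) p.224 («M is a size of big blocks … will be fixed later»), (2.60) p.234; derivation ours] -/
theorem powL_sq_le_of_levelGap (D : TDomains d ℓ Mh k P' R) (hMh : 1 ≤ Mh) (hP : ∀ μ, 1 ≤ P' μ) {δ : ℝ} (hδ : 0 ≤ δ)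
    (habs : 2 * Real.log ((ℓ : ℝ) + 1) ≤ δ * (((R * ((ℓ + 1) * Mh) - 1 : ℕ)) : ℝ)) (y y' : (geomT D).Site) :
    ((((ℓ : ℝ) + 1)) ^ y'.1.1) ^ 2 ≤ ((ℓ : ℝ) + 1) ^ 2 * Real.exp (δ * (geomT D).dist y y') * ((((ℓ : ℝ) + 1)) ^ y.1.1) ^ 2 := by
  set Lr : ℝ := (ℓ : ℝ) + 1 with hLr
  have hL1 : 1 ≤ Lr := by rw [hLr]; linarith [(Nat.cast_nonneg ℓ : (0 : ℝ) ≤ ℓ)]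
  have hL0 : 0 < Lr := by linarith
  have hlog : 0 ≤ Real.log Lr := Real.log_nonneg hL1
  have hd0 : 0 ≤ (geomT D).dist y y' := geomT_dist_nonneg D y y'
  have hE1 : 1 ≤ Real.exp (δ * (geomT D).dist y y') := Real.one_le_exp (mul_nonneg hδ hd0)
  set j : ℕ := y.1.1 with hj
  set j' : ℕ := y'.1.1 with hj'
  by_cases hle : j' ≤ j
  · -- `L^{j′} ≤ L^{j}` and `L²e^{δd} ≥ 1`
    have h1 : Lr ^ j' ≤ Lr ^ j := pow_le_pow_right₀ hL1 hle
    have h2 : (Lr ^ j') ^ 2 ≤ (Lr ^ j) ^ 2 := pow_le_pow_left₀ (pow_nonneg hL0.le _) h1 2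
    have h3 : (1 : ℝ) ≤ Lr ^ 2 * Real.exp (δ * (geomT D).dist y y') :=
      one_le_mul_of_one_le_of_one_le (one_le_pow₀ hL1) hE1
    calc (Lr ^ j') ^ 2 ≤ (Lr ^ j) ^ 2 := h2
      _ = 1 * (Lr ^ j) ^ 2 := (one_mul _).symm
      _ ≤ Lr ^ 2 * Real.exp (δ * (geomT D).dist y y') * (Lr ^ j) ^ 2 :=
          mul_le_mul_of_nonneg_right h3 (sq_nonneg _)
  · -- `j < j′`: `(R·L·M_h − 1)(j′ − j − 1) ≤ d_T`, so `L^{2(j′−j−1)} ≤ e^{δd_T}`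
    have hlt : j < j' := lt_of_not_ge hle
    have hgap := levelGap_le_dist D hMh hP y y'
    have hjr : (j : ℝ) + 1 ≤ j' := by exact_mod_cast hlt
    have hcast : ((j' - j - 1 : ℕ) : ℝ) = (j' : ℝ) - j - 1 := by
      rw [Nat.cast_sub (by omega), Nat.cast_sub hlt.le, Nat.cast_one]
    have hmax : max (|((y.1.1 : ℕ) : ℝ) - ((y'.1.1 : ℕ) : ℝ)| - 1) 0 = ((j' - j - 1 : ℕ) : ℝ) := by
      rw [hcast]
      show max (|(j : ℝ) - j'| - 1) 0 = _
      rw [abs_sub_comm, abs_of_nonneg (by linarith), max_eq_left (by linarith)]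
    rw [hmax] at hgap
    -- `2(j′ − j − 1) log L ≤ δ d_T`
    have hkey : 2 * ((j' - j - 1 : ℕ) : ℝ) * Real.log Lr ≤ δ * (geomT D).dist y y' := by
      have hn0 : 0 ≤ ((j' - j - 1 : ℕ) : ℝ) := Nat.cast_nonneg _
      calc 2 * ((j' - j - 1 : ℕ) : ℝ) * Real.log Lr = (2 * Real.log Lr) * ((j' - j - 1 : ℕ) : ℝ) := by ring
        _ ≤ (δ * ((((R * ((ℓ + 1) * Mh) - 1 : ℕ)) : ℝ))) * ((j' - j - 1 : ℕ) : ℝ) :=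
            mul_le_mul_of_nonneg_right habs hn0
        _ = δ * (((((R * ((ℓ + 1) * Mh) - 1 : ℕ)) : ℝ)) * ((j' - j - 1 : ℕ) : ℝ)) := by ring
        _ ≤ δ * (geomT D).dist y y' := mul_le_mul_of_nonneg_left hgap hδ
    have hpow : (Lr ^ (j' - j - 1)) ^ 2 ≤ Real.exp (δ * (geomT D).dist y y') := by
      rw [← pow_mul, ← Real.exp_log (pow_pos hL0 _), Real.log_pow, Real.exp_le_exp]
      push_cast
      linarith
    have hsplit : Lr ^ j' = Lr ^ j * Lr * Lr ^ (j' - j - 1) := by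
      rw [← pow_succ, ← pow_add]
      congr 1
      omega
    calc (Lr ^ j') ^ 2 = (Lr ^ (j' - j - 1)) ^ 2 * (Lr ^ 2 * (Lr ^ j) ^ 2) := by rw [hsplit]; ring
      _ ≤ Real.exp (δ * (geomT D).dist y y') * (Lr ^ 2 * (Lr ^ j) ^ 2) :=
          mul_le_mul_of_nonneg_right hpow (by positivity)
      _ = Lr ^ 2 * Real.exp (δ * (geomT D).dist y y') * (Lr ^ j) ^ 2 := by ring

/-- **THE LEVEL FACTOR**: `pref c′ y′ ≤ L²·e^{δd_T(y,y′)}·pref c′ y` whenever `2 log L ≤ δ·(R·L·M_h − 1)` (`δ ≥ 0`).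
[cite: Balaban1984PropagatorsII, (2.136)/(2.140) p.247 (the prefactor `(Lʲη)²` of the output block), (2.2) p.224; derivation ours] -/
theorem pref_le_of_levelGap (D : TDomains d ℓ Mh k P' R) (hMh : 1 ≤ Mh) (hP : ∀ μ, 1 ≤ P' μ) (c' : ℝ) {δ : ℝ} (hδ : 0 ≤ δ)
    (habs : 2 * Real.log ((ℓ : ℝ) + 1) ≤ δ * (((R * ((ℓ + 1) * Mh) - 1 : ℕ)) : ℝ)) (y y' : (geomT D).Site) :
    pref c' y' ≤ ((ℓ : ℝ) + 1) ^ 2 * Real.exp (δ * (geomT D).dist y y') * pref c' y := by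
  rw [pref_eq, pref_eq, ← mul_div_assoc]
  push_cast
  exact div_le_div_of_nonneg_right (powL_sq_le_of_levelGap D hMh hP hδ habs y y') (sq_nonneg _)

end Level

/-! ## §4  The first `L²` entry of (2.140) at k levels for the genuine `G` -/

section KLevel

variable {d ℓ m K : ℕ} {hd : 1 ≤ d + 1} {hL : Odd (ℓ + 1) ∧ 1 < ℓ + 1} {Mh k R : ℕ} {P' : Fin (d + 1) → ℕ}

/-- **SUP MAJORANT OF THE LANDED SHAPE ⇒ THE `L²` ENTRY** for the genuine `G = GE (domT hN D hk)`: if `onFun G` has the majorant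
`A·pref cf y·e^{−δd_T(y,y′)}` on the blocks of the V1 torus (`A ≥ 0`, `δ ≥ 0`) and `2 log L ≤ δ·(R·L·M_h − 1)`, then for `supp ζ ⊂ Δ(y)`, `|ζ| ≤ s`,
`supp J ⊂ Δ(y′)`: `Σ_x (ζ(x)(GJ)(x))² ≤ (A·L·pref cf y·e^{−(δ/2)d_T(y,y′)}·s)²·Σ_x J(x)²` (Schur test §1 with the symmetry §2 and the level
factor §3). [cite: Balaban1984PropagatorsII, Prop. 2.6 (2.140) p.247 (first entry); derivation ours] -/
theorem sum_sq_le_of_hasMajorant_GE (hN : ∀ μ, N0 ℓ Mh k P' μ = (PV d ℓ m K hd hL).sitesPerDir 0) (D : TDomains d ℓ Mh k P' R)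
    (hk : k ≤ m + K) (hMh : 1 ≤ Mh) (hP : ∀ μ, 1 ≤ P' μ) {cf : ℝ} (hcf : cf ≠ 0) {w : BondIdx (domT hN D hk) → ℝ} (hw : ∀ i, 0 < w i)
    {A δ : ℝ} (hA : 0 ≤ A) (hδ : 0 ≤ δ) (habs : 2 * Real.log ((ℓ : ℝ) + 1) ≤ δ * (((R * ((ℓ + 1) * Mh) - 1 : ℕ)) : ℝ))
    (hT : HasMajorant (g := geomT D) (blkV1 hN D) (onFun (GE (domT hN D hk) hcf hw))
      (fun y y' => A * pref cf y * Real.exp (-(δ * (geomT D).dist y y'))))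
    (y y' : (geomT D).Site) (ζ J : PBond (PV d ℓ m K hd hL) 0 → ℝ) {s : ℝ}
    (hζ : ∀ x, blkV1 hN D x ≠ y → ζ x = 0) (hζs : ∀ x, |ζ x| ≤ s) (hJ : ∀ x, blkV1 hN D x ≠ y' → J x = 0) :
    ∑ x, (ζ x * onFun (GE (domT hN D hk) hcf hw) J x) ^ 2 ≤
      (A * ((ℓ : ℝ) + 1) * pref cf y * Real.exp (-(δ / 2 * (geomT D).dist y y')) * s) ^ 2 * ∑ x, J x ^ 2 := by
  classical
  have hK : ∀ y y' : (geomT D).Site, 0 ≤ A * pref cf y * Real.exp (-(δ * (geomT D).dist y y')) := fun y y' =>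
    mul_nonneg (mul_nonneg hA (pref_nonneg cf y)) (Real.exp_nonneg _)
  have h1 := sum_sq_cut_apply_le_of_hasMajorant_symm (blkV1 hN D) hT hK (onFun_GE_single_symm (domT hN D hk) hcf hw)
    y y' ζ J hζ hζs hJ
  refine h1.trans (mul_le_mul_of_nonneg_right ?_ (Finset.sum_nonneg fun x _ => sq_nonneg _))
  -- `K(y,y′)K(y′,y) ≤ (A·L·pref y·e^{−δd/2})²`
  have hsymm : (geomT D).dist y' y = (geomT D).dist y y' := by
    rw [geomT_dist_eq, geomT_dist_eq, SimpleGraph.dist_comm]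
  have hlev := pref_le_of_levelGap D hMh hP cf hδ habs y y'
  have hE : Real.exp (-(δ * (geomT D).dist y y')) * Real.exp (-(δ * (geomT D).dist y y')) * Real.exp (δ * (geomT D).dist y y') =
      Real.exp (-(δ / 2 * (geomT D).dist y y')) ^ 2 := by
    rw [← Real.exp_add, ← Real.exp_add, sq, ← Real.exp_add]
    congr 1; ring
  have hp0 : 0 ≤ pref cf y := pref_nonneg cf y
  have he0 : 0 ≤ Real.exp (-(δ * (geomT D).dist y y')) := Real.exp_nonneg _
  calc s ^ 2 * (A * pref cf y * Real.exp (-(δ * (geomT D).dist y y')) * (A * pref cf y' * Real.exp (-(δ * (geomT D).dist y' y))))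
      = s ^ 2 * (A ^ 2 * pref cf y * (Real.exp (-(δ * (geomT D).dist y y')) * Real.exp (-(δ * (geomT D).dist y y'))) * pref cf y') := by
        rw [hsymm]; ring
    _ ≤ s ^ 2 * (A ^ 2 * pref cf y * (Real.exp (-(δ * (geomT D).dist y y')) * Real.exp (-(δ * (geomT D).dist y y'))) *
          (((ℓ : ℝ) + 1) ^ 2 * Real.exp (δ * (geomT D).dist y y') * pref cf y)) := by
        exact mul_le_mul_of_nonneg_left (mul_le_mul_of_nonneg_left hlev
          (mul_nonneg (mul_nonneg (sq_nonneg _) hp0) (mul_nonneg he0 he0))) (sq_nonneg _)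
    _ = (A * ((ℓ : ℝ) + 1) * pref cf y * s) ^ 2 *
          (Real.exp (-(δ * (geomT D).dist y y')) * Real.exp (-(δ * (geomT D).dist y y')) * Real.exp (δ * (geomT D).dist y y')) := by
        ring
    _ = (A * ((ℓ : ℝ) + 1) * pref cf y * Real.exp (-(δ / 2 * (geomT D).dist y y')) * s) ^ 2 := by rw [hE]; ring

/-- the absorption threshold: `L·M_h ≥ 2 log L/δ + 1` and `R ≥ 2L² ≥ 2` give `2 log L ≤ δ·(R·L·M_h − 1)`.
[cite: Balaban1984PropagatorsII, (2.2) p.224 («R is a big positive integer which will be fixed later»); bookkeeping ours] -/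
theorem absorb_of_threshold {δ : ℝ} (hδ : 0 < δ) (hℓ : 1 ≤ ℓ) (hMh : 1 ≤ Mh) (hR2 : 2 * (ℓ + 1) ^ 2 ≤ R)
    (hM : 2 * Real.log ((ℓ : ℝ) + 1) / δ + 1 ≤ ((ℓ : ℝ) + 1) * Mh) :
    2 * Real.log ((ℓ : ℝ) + 1) ≤ δ * (((R * ((ℓ + 1) * Mh) - 1 : ℕ)) : ℝ) := by
  have hlog : 0 ≤ Real.log ((ℓ : ℝ) + 1) := Real.log_nonneg (by linarith [(Nat.cast_nonneg ℓ : (0 : ℝ) ≤ ℓ)])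
  have h1 : 1 ≤ (ℓ + 1) ^ 2 := Nat.one_le_pow _ _ (Nat.succ_pos ℓ)
  have h2 : 2 ≤ R := le_trans (Nat.mul_le_mul_left 2 h1) hR2
  have hR : (2 : ℝ) ≤ R := by exact_mod_cast h2
  have hprod : 1 ≤ R * ((ℓ + 1) * Mh) := Nat.mul_pos (by omega) (Nat.mul_pos (Nat.succ_pos ℓ) (by omega))
  have hcast : (((R * ((ℓ + 1) * Mh) - 1 : ℕ)) : ℝ) = (R : ℝ) * (((ℓ : ℝ) + 1) * Mh) - 1 := by
    rw [Nat.cast_sub hprod]; push_cast; ring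
  rw [hcast]
  have hLM : 0 ≤ ((ℓ : ℝ) + 1) * Mh := by positivity
  have hx : 2 * Real.log ((ℓ : ℝ) + 1) / δ ≤ ((ℓ : ℝ) + 1) * Mh - 1 := by linarith
  have hx' : 2 * Real.log ((ℓ : ℝ) + 1) ≤ δ * (((ℓ : ℝ) + 1) * Mh - 1) := by
    rw [div_le_iff₀ hδ] at hx; linarith
  have hstep : ((ℓ : ℝ) + 1) * Mh - 1 ≤ (R : ℝ) * (((ℓ : ℝ) + 1) * Mh) - 1 := by
    nlinarith [mul_nonneg (by linarith : (0 : ℝ) ≤ (R : ℝ) - 1) hLM]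
  calc 2 * Real.log ((ℓ : ℝ) + 1) ≤ δ * (((ℓ : ℝ) + 1) * Mh - 1) := hx'
    _ ≤ δ * ((R : ℝ) * (((ℓ : ℝ) + 1) * Mh) - 1) := mul_le_mul_of_nonneg_left hstep hδ.le

/-- **PROPOSITION 2.6, THE FIRST `L²` ENTRY OF (2.140), AT k LEVELS FOR THE GENUINE `G = Δ_a⁻¹` ON THE V1 TORUS**: *"‖ζGJ‖ ≤ O(1)(Lʲη)²|ζ|
e^{−δ₃d(y,y′)}‖J‖ if supp ζ ⊂ Δ(y), y ∈ Λ_j, supp J ⊂ Δ(y′)"* — binders of r03's `B6Line3CubeV1.prop26_2136_kLevel_unconditional` (V1 torus, `k ≥ 2`,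
`M_h = L^a ≥ 8`, `R ≥ 2L²`, `P′_μ ≥ 5`, odd `L ≥ 5`, every cube placed, `M₂ ≤ L·M_h`, weights in the band (2.16)) with `α < 1`; conclusion in the
unweighted `ℓ²` sums over the fine bonds: `Σ_x (ζ(x)(GJ)(x))² ≤ (A·pref cf y·e^{−(δ₃(α,2σ)/2)d_T(y,y′)}·s)²·Σ_x J(x)²` for `|ζ| ≤ s`.  From the
landed sup entry (2.136)₁ by symmetry + the Schur test (§1–§3); rate `δ₃/2` and the constant ours.
[cite: Balaban1984PropagatorsII, Prop. 2.6 (2.140) p.247 (first entry), (2.136) p.247, (2.2) p.224] -/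
theorem ineq2140_kLevel_unconditional (d ℓ : ℕ) (hd : 1 ≤ d + 1) (hL : Odd (ℓ + 1) ∧ 1 < ℓ + 1) {b₀ b₁ : ℝ} (hb₀ : 0 < b₀)
    (hb₁ : b₀ ≤ b₁) :
    ∃ σ₁ : ℝ, 0 < σ₁ ∧ ∀ (σ : ℝ), 0 < σ → σ ≤ σ₁ → ∀ (α : ℝ), 0 < α → α < 1 →
    ∃ A M₂ : ℝ, 0 ≤ A ∧ 0 < M₂ ∧
    ∀ (m K : ℕ) {Mh k R : ℕ} {P' : Fin (d + 1) → ℕ}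
      (hN : ∀ μ, N0 ℓ Mh k P' μ = (PV d ℓ m K hd hL).sitesPerDir 0) (D : TDomains d ℓ Mh k P' R) (hk : k ≤ m + K) (_ : 2 ≤ k)
      {a : ℕ} (_ : Mh = (ℓ + 1) ^ a) (_ : 8 ≤ Mh) (_ : 2 * (ℓ + 1) ^ 2 ≤ R) (_ : ∀ μ, 5 ≤ P' μ) (_ : 4 ≤ ℓ)
      (_ : ∀ c : ↥(cubes D.toDomains), Placed ℓ k P' c.1) (_ : M₂ ≤ ((ℓ : ℝ) + 1) * Mh)
      {cf : ℝ} (hcf : cf ≠ 0) {w : BondIdx (domT hN D hk) → ℝ} (hw : ∀ i, 0 < w i) (_ : GlobalBand b₀ b₁ cf w)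
      (y y' : (geomT D).Site) (ζ J : PBond (PV d ℓ m K hd hL) 0 → ℝ) {s : ℝ}
      (_ : ∀ x, blkV1 hN D x ≠ y → ζ x = 0) (_ : ∀ x, |ζ x| ≤ s) (_ : ∀ x, blkV1 hN D x ≠ y' → J x = 0),
      ∑ x, (ζ x * onFun (GE (domT hN D hk) hcf hw) J x) ^ 2 ≤
        (A * pref cf y * Real.exp (-(delta3 α (2 * σ) / 2 * (geomT D).dist y y')) * s) ^ 2 * ∑ x, J x ^ 2 := by
  obtain ⟨σ₁, hσ₁, h⟩ := prop26_2136_kLevel_unconditional d ℓ hd hL hb₀ hb₁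
  refine ⟨σ₁, hσ₁, fun σ hσ hσ1 α hα hα1 => ?_⟩
  obtain ⟨A, M₂, hA, hM₂, h2⟩ := h σ hσ hσ1 α hα hα1.le
  have hδ : 0 < delta3 α (2 * σ) := delta3_pos hα1 (by linarith)
  refine ⟨A * ((ℓ : ℝ) + 1), max M₂ (2 * Real.log ((ℓ : ℝ) + 1) / delta3 α (2 * σ) + 1),
    mul_nonneg hA (by positivity), lt_max_of_lt_left hM₂, ?_⟩
  intro m K Mh k R P' hN D hk hk2 a hMha hM8 hR2 hP5 hℓ hpl hM cf hcf w hw hwb y y' ζ J s hζ hζs hJ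
  have hT := h2 m K hN D hk hk2 hMha hM8 hR2 hP5 hℓ hpl ((le_max_left _ _).trans hM) hcf hw hwb
  have habs := absorb_of_threshold (R := R) hδ (by omega) (by omega) hR2 ((le_max_right _ _).trans hM)
  exact sum_sq_le_of_hasMajorant_GE hN D hk (by omega) (fun μ => le_trans (by norm_num) (hP5 μ)) hcf hw hA hδ.le habs hT
    y y' ζ J hζ hζs hJ

/-- **THE SAME AT `L = 5`, `P′_μ ≥ 12`: THE PLACEMENT DISCHARGED** (from r03's `prop26_2136_kLevel_unconditional_L5`).
[cite: Balaban1984PropagatorsII, Prop. 2.6 (2.140) p.247 (first entry), (2.136) p.247, (2.2) p.224] -/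
theorem ineq2140_kLevel_unconditional_L5 (d : ℕ) (hd : 1 ≤ d + 1) (hL : Odd (4 + 1) ∧ 1 < 4 + 1) {b₀ b₁ : ℝ} (hb₀ : 0 < b₀)
    (hb₁ : b₀ ≤ b₁) :
    ∃ σ₁ : ℝ, 0 < σ₁ ∧ ∀ (σ : ℝ), 0 < σ → σ ≤ σ₁ → ∀ (α : ℝ), 0 < α → α < 1 →
    ∃ A M₂ : ℝ, 0 ≤ A ∧ 0 < M₂ ∧
    ∀ (m K : ℕ) {Mh k R : ℕ} {P' : Fin (d + 1) → ℕ}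
      (hN : ∀ μ, N0 4 Mh k P' μ = (PV d 4 m K hd hL).sitesPerDir 0) (D : TDomains d 4 Mh k P' R) (hk : k ≤ m + K) (_ : 2 ≤ k)
      {a : ℕ} (_ : Mh = (4 + 1) ^ a) (_ : 8 ≤ Mh) (_ : 2 * (4 + 1) ^ 2 ≤ R) (_ : ∀ μ, 12 ≤ P' μ) (_ : M₂ ≤ (((4 : ℕ) : ℝ) + 1) * Mh)
      {cf : ℝ} (hcf : cf ≠ 0) {w : BondIdx (domT hN D hk) → ℝ} (hw : ∀ i, 0 < w i) (_ : GlobalBand b₀ b₁ cf w)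
      (y y' : (geomT D).Site) (ζ J : PBond (PV d 4 m K hd hL) 0 → ℝ) {s : ℝ}
      (_ : ∀ x, blkV1 hN D x ≠ y → ζ x = 0) (_ : ∀ x, |ζ x| ≤ s) (_ : ∀ x, blkV1 hN D x ≠ y' → J x = 0),
      ∑ x, (ζ x * onFun (GE (domT hN D hk) hcf hw) J x) ^ 2 ≤
        (A * pref cf y * Real.exp (-(delta3 α (2 * σ) / 2 * (geomT D).dist y y')) * s) ^ 2 * ∑ x, J x ^ 2 := by
  obtain ⟨σ₁, hσ₁, h⟩ := prop26_2136_kLevel_unconditional_L5 d hd hL hb₀ hb₁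
  refine ⟨σ₁, hσ₁, fun σ hσ hσ1 α hα hα1 => ?_⟩
  obtain ⟨A, M₂, hA, hM₂, h2⟩ := h σ hσ hσ1 α hα hα1.le
  have hδ : 0 < delta3 α (2 * σ) := delta3_pos hα1 (by linarith)
  refine ⟨A * (((4 : ℕ) : ℝ) + 1), max M₂ (2 * Real.log (((4 : ℕ) : ℝ) + 1) / delta3 α (2 * σ) + 1),
    mul_nonneg hA (by positivity), lt_max_of_lt_left hM₂, ?_⟩
  intro m K Mh k R P' hN D hk hk2 a hMha hM8 hR2 hP12 hM cf hcf w hw hwb y y' ζ J s hζ hζs hJ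
  have hT := h2 m K hN D hk hk2 hMha hM8 hR2 hP12 ((le_max_left _ _).trans hM) hcf hw hwb
  have habs := absorb_of_threshold (R := R) hδ (by omega) (by omega) hR2 ((le_max_right _ _).trans hM)
  exact sum_sq_le_of_hasMajorant_GE hN D hk (by omega) (fun μ => le_trans (by norm_num) (hP12 μ)) hcf hw hA hδ.le habs hT
    y y' ζ J hζ hζs hJ

end KLevel

end Literature.MathematicalPhysics.QuantumFieldTheory.Balaban1983to89.B6Ineq2140KLevelV1

end
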